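import Literature.NumberTheory.EllipticCurves.EisensteinSeriesNebentypusLevelRaised
import Literature.NumberTheory.LFunctions.GeneralizedBernoulliLargeWeight
import HarnessLib

/-!
# The level-raised Eisenstein series `F₂ = E_k^{𝟙,χ} - E_k^{𝟙,χ}(M·)` in the Billerey–Menares 2016
# weights: integrality of the `q`-expansion and vanishing of all constant terms modulo `𝔪`

Topic `Literature/NumberTheory/EllipticCurves`; namespace
`Literature.NumberTheory.EllipticCurves.ModularForms`.  THEOREMS ONLY (no definition, no named
fact).

`EisensteinSeriesNebentypusLevelRaised` constructs `F₂ = eisensteinLevelRaised N k χ M` (Billerey–Menares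
2018, §3.2; = the series `E = E_k^{𝟙,ε₀} - α_p E_k^{𝟙,ε₀}` of Billerey–Menares 2016, proof of
Thm. 2.2) and proves the `p`-integrality of its `q`-expansion and the vanishing modulo `𝔪` of its
constant terms at all cusps under `3 ≤ k < p - 1`, the window `l > k + 1` of B–M 2018.  The weights
of B–M 2016, Thm. 2.2 are `k ∈ {l, l + 1} ∪ [3, l - 1]`; this file removes the restriction:

* `qExpansion_coeff_eisensteinLevelRaised_mem`, `valuation_qExpansion_coeff_eisensteinLevelRaised_le_one_of_le`
  — for EVERY `k ≥ 3` the `q`-expansion of `F₂` (`a_0 = 0`,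
  `a_n = σ_{k-1}^χ(n) - [M ∣ n] σ_{k-1}^χ(n/M)`) lies in `ℤ[χ]`, hence is `p`-adically integral under
  any `ι : ℚ̄_p ≃ ℂ` — no condition on `p` at all (the Bernoulli number only enters `a_0(E_k^{𝟙,χ})`,
  which cancels in `F₂`).
* `exists_tendsto_eisensteinLevelRaised_slash_valuation_lt_one_of_lt` — the constant term of
  `F₂ ∣_k γ` at `i∞` is `0` (`M ∣ c`) or
  `-(B_{k,χ}/4k) (χ(M)M^k - 1) · χ(d)(1 + χ(-1)(-1)^k) · χ̄(M)M^{-k} · [N ∣ c]` (`gcd(c, M) = 1`), so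
  ALL constant terms have `‖ι⁻¹(·)‖_p < 1` as soon as
  `‖ι⁻¹(-(B_{k,χ}/4k)(χ(M)M^k - 1))‖_p < 1` — the printed hypothesis
  "`λ ∣ (B_{k,ε₀}/2k)(ε₀(M)M^k - 1)`" of B–M 2016, Thm. 2.2, verbatim;
* `exists_tendsto_eisensteinLevelRaised_slash_valuation_lt_one_of_weight` — that hypothesis from
  `χ(M)M^k ≡ 1 (mod 𝔪)` in the weights `k < p - 1`, `k = p - 1 ∧ χ ≠ 𝟙`, `k = p`, `k = p + 1`
  (`-(B_{k,χ}/4k)` is `p`-integral there, `GeneralizedBernoulliLargeWeight`);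
* `exists_tendsto_eisensteinLevelRaised_slash_valuation_lt_one_corner` — and in the corner
  `(N, k, χ) = (1, p - 1, 𝟙)` from `M^{p-1} ≡ 1 (mod p²)` (`v_p(B_{p-1}) = -1`).

## References

* N. Billerey, R. Menares, *On the modularity of reducible mod `l` Galois representations*, Math.
  Res. Lett. 23 (2016), §2, Thm. 2.2 and its proof; Prop. 1.2. [BillereyMenares2016]
* N. Billerey, R. Menares, *Strong modularity of reducible Galois representations*, Trans. AMS 370
  (2018), Cor. 5, §3.2. [BillereyMenares2018]
* L. C. Washington, *Introduction to Cyclotomic Fields*, GTM 83 (1997), Thm. 5.10, §5.3.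
  [Washington1997]
-/

noncomputable section

open Complex UpperHalfPlane Filter Finset ModularForm CongruenceSubgroup Matrix
  Matrix.SpecialLinearGroup
open scoped Real NNReal MatrixGroups Topology
open Literature.NumberTheory.LFunctions

namespace Literature.NumberTheory.EllipticCurves.ModularForms

/-! ### The `q`-expansion of `F₂` is integral for every `k ≥ 3` -/

section QExpansion

variable {N : ℕ} [NeZero N] (k : ℕ) (χ : DirichletCharacter ℂ N) (M : ℕ) [NeZero M]

/-- **The coefficients of `F₂` lie in `ℤ[χ]`**: for `χ` primitive with `χ(-1) = (-1)^k`, `k ≥ 3`,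
every `a_n(F₂)` (`= 0` for `n = 0`, `σ_{k-1}^χ(n) - [M ∣ n] σ_{k-1}^χ(n/M)` otherwise) lies in any
subring of `ℂ` containing the values of `χ`. [cite: BillereyMenares2016, §2, proof of Thm. 2.2] -/
theorem qExpansion_coeff_eisensteinLevelRaised_mem (hk : 3 ≤ k) (hχ : χ.IsPrimitive)
    (hpar : χ (-1) = (-1) ^ k) (S : Subring ℂ) (hχS : ∀ j, χ j ∈ S) (n : ℕ) :
    (qExpansion 1 ⇑(eisensteinLevelRaised N k χ M hk)).coeff n ∈ S := by
  have hσ : ∀ m : ℕ, ∑ d ∈ m.divisors, χ d * (d : ℂ) ^ (k - 1) ∈ S := fun m ↦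
    Subring.sum_mem S fun d _ ↦ Subring.mul_mem S (hχS d) (Subring.pow_mem S (natCast_mem S d) _)
  rw [qExpansion_coeff_eisensteinLevelRaised k χ M hk hχ hpar n]
  split_ifs
  · exact Subring.zero_mem S
  · exact Subring.sub_mem S (hσ _) (hσ _)
  · rw [sub_zero]; exact hσ _

/-- **The `q`-expansion of `F₂` is `p`-adically integral for every `k ≥ 3`** and every
identification `ι : ℚ̄_p ≃ ℂ` (any prime `p`): `‖ι⁻¹(a_n(F₂))‖_p ≤ 1`.
[cite: BillereyMenares2016, §2, proof of Thm. 2.2] -/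
theorem valuation_qExpansion_coeff_eisensteinLevelRaised_le_one_of_le {p : ℕ} [Fact p.Prime]
    (ι : PadicAlgCl p ≃+* ℂ) (hk : 3 ≤ k) (hχ : χ.IsPrimitive) (hpar : χ (-1) = (-1) ^ k) (n : ℕ) :
    Valued.v (ι.symm ((qExpansion 1 ⇑(eisensteinLevelRaised N k χ M hk)).coeff n)) ≤ 1 := by
  set S : Subring ℂ :=
    ((Valued.v (R := PadicAlgCl p)).valuationSubring.toSubring).comap ι.symm.toRingHom with hS
  have hmem : ∀ x : ℂ, x ∈ S ↔ Valued.v (ι.symm x) ≤ 1 := fun x ↦ by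
    simp [hS, Valuation.mem_valuationSubring_iff]
  rw [← hmem]
  exact qExpansion_coeff_eisensteinLevelRaised_mem k χ M hk hχ hpar S
    (fun j ↦ (hmem _).2 (valuation_ringEquiv_symm_apply_le_one χ ι j)) n

end QExpansion

/-! ### All constant terms of `F₂` vanish modulo `𝔪` -/

section Cusps

variable {N : ℕ} [NeZero N] (k : ℕ) (χ : DirichletCharacter ℂ N) (M : ℕ) [NeZero M]
variable {p : ℕ} [Fact p.Prime]

omit [NeZero M] in
/-- `‖M‖_p = 1` in `ℚ̄_p` for a prime `M ≠ p`. [folklore] -/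
theorem valuation_natCast_padicAlgCl_eq_one (hM : M.Prime) (hMp : M ≠ p) :
    Valued.v ((M : PadicAlgCl p)) = 1 := by
  rw [PadicAlgCl.valuation_def, ← map_natCast (algebraMap ℚ_[p] (PadicAlgCl p)) M]
  change (‖((M : ℚ_[p]) : PadicAlgCl p)‖₊ : ℝ≥0) = 1
  rw [← NNReal.coe_inj, coe_nnnorm, NNReal.coe_one, PadicAlgCl.norm_extends,
    Padic.norm_natCast_eq_one_iff]
  exact (Nat.coprime_primes Fact.out hM).2 hMp.symm

/-- `‖p‖_p < 1` in `ℚ̄_p`. [folklore] -/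
theorem valuation_natCast_padicAlgCl_self_lt_one : Valued.v ((p : PadicAlgCl p)) < 1 := by
  rw [PadicAlgCl.valuation_def, ← map_natCast (algebraMap ℚ_[p] (PadicAlgCl p)) p]
  change (‖((p : ℚ_[p]) : PadicAlgCl p)‖₊ : ℝ≥0) < 1
  rw [← NNReal.coe_lt_coe, coe_nnnorm, NNReal.coe_one, PadicAlgCl.norm_extends]
  exact Padic.norm_p_lt_one

set_option maxHeartbeats 400000 in
/-- **All constant terms of `F₂` vanish modulo `𝔪` under the printed hypothesis of
Billerey–Menares 2016, Thm. 2.2** ("`λ` divides `(B_{k,ε₀}/2k)(ε₀(M)M^k - 1)`", read in `ℚ̄_p` via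
`ι⁻¹` as `‖ι⁻¹(-(B_{k,χ}/4k)(χ(M)M^k - 1))‖_p < 1`): for a prime `M ≠ p` coprime to `N` and every
`γ ∈ SL₂(ℤ)`, `F₂ ∣_k γ → c_γ` at `i∞` with `‖ι⁻¹(c_γ)‖_p < 1` — for `c_γ = 0` if `M ∣ c` and
`c_γ = -(B_{k,χ}/4k)(χ(M)M^k - 1) · χ(d)(1 + χ(-1)(-1)^k) · χ̄(M)M^{-k} · [N ∣ c]` otherwise
(Billerey–Menares 2016, Prop. 1.2 / 2018, Cor. 5).  No condition on the weight `k ≥ 3`.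
[cite: BillereyMenares2016, §2, Thm. 2.2 (proof) and Prop. 1.2] -/
theorem exists_tendsto_eisensteinLevelRaised_slash_valuation_lt_one_of_lt
    (ι : PadicAlgCl p ≃+* ℂ) (hk : 3 ≤ k) (hM : M.Prime) (hMp : M ≠ p) (hMN : M.Coprime N)
    (hQ : Valued.v (ι.symm (-(generalizedBernoulli k χ) / (4 * k) *
      (χ (M : ZMod N) * (M : ℂ) ^ (k : ℤ) - 1))) < 1)
    (γ : SL(2, ℤ)) :
    ∃ c : ℂ, Tendsto ((⇑(eisensteinLevelRaised N k χ M hk) : ℍ → ℂ) ∣[(k : ℤ)] γ) atImInfty (𝓝 c) ∧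
      Valued.v (ι.symm c) < 1 := by
  rcases dvd_or_isCoprime_of_prime hM (γ 1 0) with hdvd | hcop
  · exact ⟨0, tendsto_eisensteinLevelRaised_slash_atImInfty_of_dvd k χ M hk hMN hdvd,
      by rw [map_zero, Valuation.map_zero]; exact zero_lt_one⟩
  · refine ⟨_, tendsto_eisensteinLevelRaised_slash_atImInfty_of_isCoprime k χ M hk hMN hcop, ?_⟩
    split_ifs with hc
    · -- the unit factors `χ(d)(1 + χ(-1)(-1)^k)` and `χ̄(M) M^{-k}`
      have hMunit : IsUnit ((M : ZMod N)) := (ZMod.isUnit_iff_coprime M N).2 hMN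
      have hχM : χ⁻¹ (M : ZMod N) * χ (M : ZMod N) = 1 := by
        rw [← MulChar.mul_apply, inv_mul_cancel, MulChar.one_apply hMunit]
      have hM0 : (M : ℂ) ≠ 0 := by exact_mod_cast hM.ne_zero
      have hfac : (1 - χ⁻¹ (M : ZMod N) * (M : ℂ) ^ (-(k : ℤ))) =
          (χ⁻¹ (M : ZMod N) * (M : ℂ) ^ (-(k : ℤ))) * (χ (M : ZMod N) * (M : ℂ) ^ (k : ℤ) - 1) := by
        have : χ⁻¹ (M : ZMod N) * (M : ℂ) ^ (-(k : ℤ)) * (χ (M : ZMod N) * (M : ℂ) ^ (k : ℤ)) = 1 := by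
          calc _ = (χ⁻¹ (M : ZMod N) * χ (M : ZMod N)) * ((M : ℂ) ^ (-(k : ℤ)) * (M : ℂ) ^ (k : ℤ)) := by
                ring
            _ = 1 := by rw [hχM, ← zpow_add₀ hM0, neg_add_cancel, zpow_zero, mul_one]
        linear_combination -this
      set S : Subring ℂ :=
        ((Valued.v (R := PadicAlgCl p)).valuationSubring.toSubring).comap ι.symm.toRingHom with hS
      have hmem : ∀ x : ℂ, x ∈ S ↔ Valued.v (ι.symm x) ≤ 1 := fun x ↦ by
        simp [hS, Valuation.mem_valuationSubring_iff]
      have hχS : ∀ j, χ j ∈ S := fun j ↦ (hmem _).2 (valuation_ringEquiv_symm_apply_le_one χ ι j)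
      have hv1 : Valued.v (ι.symm (χ ((γ 1 1 : ℤ) : ZMod N) * (1 + χ (-1) * (-1) ^ (k : ℤ)))) ≤ 1 := by
        rw [← hmem]
        refine Subring.mul_mem S (hχS _) (Subring.add_mem S (Subring.one_mem S)
          (Subring.mul_mem S (hχS _) ?_))
        rw [zpow_natCast]
        exact Subring.pow_mem S (Subring.neg_mem S (Subring.one_mem S)) _
      have hv2 : Valued.v (ι.symm (χ⁻¹ (M : ZMod N) * (M : ℂ) ^ (-(k : ℤ)))) ≤ 1 := by
        have h1 : Valued.v (ι.symm (χ⁻¹ (M : ZMod N))) ≤ 1 :=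
          valuation_ringEquiv_symm_apply_le_one χ⁻¹ ι _
        have h2 : Valued.v (ι.symm ((M : ℂ) ^ (-(k : ℤ)))) = 1 := by
          rw [map_zpow₀, map_natCast ι.symm, map_zpow₀, valuation_natCast_padicAlgCl_eq_one M hM hMp,
            _root_.one_zpow]
        rw [map_mul, Valuation.map_mul, h2, mul_one]
        exact h1
      have hX : -(generalizedBernoulli k χ) / (4 * k) * (χ ((γ 1 1 : ℤ) : ZMod N) *
          (1 + χ (-1) * (-1) ^ (k : ℤ)) * (1 - χ⁻¹ (M : ZMod N) * (M : ℂ) ^ (-(k : ℤ)))) =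
          (-(generalizedBernoulli k χ) / (4 * k) * (χ (M : ZMod N) * (M : ℂ) ^ (k : ℤ) - 1)) *
            (χ ((γ 1 1 : ℤ) : ZMod N) * (1 + χ (-1) * (-1) ^ (k : ℤ))) *
              (χ⁻¹ (M : ZMod N) * (M : ℂ) ^ (-(k : ℤ))) := by
        rw [hfac]; ring
      rw [hX, map_mul ι.symm, map_mul ι.symm, Valuation.map_mul, Valuation.map_mul]
      calc _ ≤ Valued.v (ι.symm (-(generalizedBernoulli k χ) / (4 * k) *
              (χ (M : ZMod N) * (M : ℂ) ^ (k : ℤ) - 1))) * 1 * 1 :=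
            mul_le_mul' (mul_le_mul' le_rfl hv1) hv2
        _ < 1 := by rw [mul_one, mul_one]; exact hQ
    · rw [mul_zero, map_zero, Valuation.map_zero]; exact zero_lt_one

/-- **The printed hypothesis from `χ(M)M^k ≡ 1` off the corner**: for `p ≥ 5`, `p ∤ N`, `M` a prime
`≠ p` coprime to `N`, `χ(M) M^k ≡ 1 (mod 𝔪)`, and a weight `k ≥ 3` with [`k < p - 1`, or
`k = p - 1 ∧ χ ≠ 𝟙`, or `k = p`, or `k = p + 1`] — all the weights of B–M 2016, Thm. 2.2 except
`(k, ε) = (l - 1, 𝟙)`, and the window of B–M 2018 — all constant terms of `F₂` vanish modulo `𝔪`.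
[cite: BillereyMenares2016, §2, Thm. 2.2 (proof)] [cite: Washington1997, §5.3] -/
theorem exists_tendsto_eisensteinLevelRaised_slash_valuation_lt_one_of_weight
    (ι : PadicAlgCl p ≃+* ℂ) (hp5 : 5 ≤ p) (hN : ¬ p ∣ N) (hk : 3 ≤ k)
    (hkw : k < p - 1 ∨ (k = p - 1 ∧ χ ≠ 1) ∨ k = p ∨ k = p + 1)
    (hM : M.Prime) (hMp : M ≠ p) (hMN : M.Coprime N)
    (hcong : Valued.v (ι.symm ((χ (M : ZMod N) : ℂ) * (M : ℂ) ^ (k : ℤ)) - 1) < 1)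
    (γ : SL(2, ℤ)) :
    ∃ c : ℂ, Tendsto ((⇑(eisensteinLevelRaised N k χ M hk) : ℍ → ℂ) ∣[(k : ℤ)] γ) atImInfty (𝓝 c) ∧
      Valued.v (ι.symm c) < 1 := by
  refine exists_tendsto_eisensteinLevelRaised_slash_valuation_lt_one_of_lt k χ M ι hk hM hMp hMN ?_ γ
  set S : Subring ℂ :=
    ((Valued.v (R := PadicAlgCl p)).valuationSubring.toSubring).comap ι.symm.toRingHom with hS
  have hmem : ∀ x : ℂ, x ∈ S ↔ Valued.v (ι.symm x) ≤ 1 := fun x ↦ by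
    simp [hS, Valuation.mem_valuationSubring_iff]
  have hB : -(generalizedBernoulli k χ) / (4 * k) ∈ S :=
    neg_generalizedBernoulli_div_mem_subring hp5 χ S
      (fun j ↦ (hmem _).2 (valuation_ringEquiv_symm_apply_le_one χ ι j))
      (fun q hq ↦ (hmem _).2 (valuation_ringEquiv_symm_ratCast_le_one ι hq)) hN hk hkw
  rw [map_mul, Valuation.map_mul]
  calc _ ≤ 1 * Valued.v (ι.symm (χ (M : ZMod N) * (M : ℂ) ^ (k : ℤ) - 1)) :=
        mul_le_mul' ((hmem _).1 hB) le_rfl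
    _ < 1 := by rw [one_mul, map_sub, map_one]; exact hcong

/-- **The corner `(N, k, χ) = (1, p - 1, 𝟙)` of Billerey–Menares 2016, Thm. 2.2**: at level `N = 1`
(so `χ = 𝟙` and `B_{k,χ} = B_{p-1}`, `v_p(B_{p-1}) = -1`), in weight `k = p - 1`, all constant terms of
`F₂ = E_{p-1} - E_{p-1}(M·)` vanish modulo `p` as soon as `M^{p-1} ≡ 1 (mod p²)` (`M` a prime `≠ p`).
[cite: BillereyMenares2016, §2, Thm. 2.2 (proof)] [cite: Washington1997, Thm. 5.10] -/
theorem exists_tendsto_eisensteinLevelRaised_slash_valuation_lt_one_corner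
    (χ : DirichletCharacter ℂ 1) (ι : PadicAlgCl p ≃+* ℂ) (hp2 : p ≠ 2) (hkp : k + 1 = p)
    (hk : 3 ≤ k) (hM : M.Prime) (hMp : M ≠ p) (hM2 : M ^ (p - 1) % p ^ 2 = 1) (γ : SL(2, ℤ)) :
    ∃ c : ℂ, Tendsto ((⇑(eisensteinLevelRaised 1 k χ M hk) : ℍ → ℂ) ∣[(k : ℤ)] γ) atImInfty (𝓝 c) ∧
      Valued.v (ι.symm c) < 1 := by
  have hp : p.Prime := Fact.out
  refine exists_tendsto_eisensteinLevelRaised_slash_valuation_lt_one_of_lt k χ M ι hk hM hMp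
    (Nat.coprime_one_right M) ?_ γ
  obtain ⟨y, hy, hy'⟩ := exists_bernoulli_div_mul_pow_sub_one_eq_mul hp2 hM2 (p := p)
  have hχ1 : χ (M : ZMod 1) = 1 := by
    rw [DirichletCharacter.level_one χ, MulChar.one_apply (isUnit_of_subsingleton _)]
  have hkp' : k = p - 1 := by omega
  have hQ : -(generalizedBernoulli k χ) / (4 * k) * (χ (M : ZMod 1) * (M : ℂ) ^ (k : ℤ) - 1) =
      -((p : ℂ) * algebraMap ℚ ℂ y) := by
    rw [hχ1, one_mul, generalizedBernoulli_modOne, zpow_natCast, hkp']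
    have h := congrArg (algebraMap ℚ ℂ) hy'
    simp only [map_mul, map_div₀, map_sub, map_pow, map_natCast, map_one, map_ofNat] at h
    push_cast [Nat.cast_sub hp.one_le]
    linear_combination -h
  rw [hQ, map_neg, Valuation.map_neg, map_mul, map_natCast, Valuation.map_mul]
  calc Valued.v ((p : PadicAlgCl p)) * Valued.v (ι.symm (algebraMap ℚ ℂ y))
        ≤ Valued.v ((p : PadicAlgCl p)) * 1 :=
        mul_le_mul' le_rfl (valuation_ringEquiv_symm_ratCast_le_one ι hy)
    _ < 1 := by rw [mul_one]; exact valuation_natCast_padicAlgCl_self_lt_one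

end Cusps

end Literature.NumberTheory.EllipticCurves.ModularForms
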